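import Summits.BirchSwinnertonDyer.BirchSwinnertonDyer.Theorems.ManinLocalTwoThreeEtaIdentitiesFortyFour
import Summits.BirchSwinnertonDyer.BirchSwinnertonDyer.Theorems.ManinLocalTwoThreeNeronSqueeze
import Summits.BirchSwinnertonDyer.BirchSwinnertonDyer.Theorems.ManinLocalTwoThreeRatioBridge
import Summits.BirchSwinnertonDyer.BirchSwinnertonDyer.Theorems.ByReductionTypeAtTwoAdditivePotGoodPrintKrizLi44a1Base
import HarnessLib

/-!
# `|c| = 1` on `X₀(44)` — UNCONDITIONALLY: the genus-FOUR level `44 = 2²·11` of the crux C2's domain (`2² ∣ 44`);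
# `N(44a1) = 44` in the kernel; the domain is inhabited under the item's modularity binder

Cell bsd-f2-manin, route `ManinLocalTwoThree` (crux C2 `ManinOddAtFour`, stmt-BirchSwinnertonDyer-22967), LEAD p1 gen 24; the capstone of
the level-`44` chain `CurveExclusionFortyFour → … → NewformPinningFortyFour` (fact-free pinning `⇑D.f = ⇑Φ₄₄` in `M₂(Γ₀(44))`, dim `9`)
`→ EtaCoordinatesFortyFour → CubicCertificateFortyFour → EtaWeightTwoFormsFortyFour → EisensteinPhiFortyFour → EtaLimitsFortyFour →
EtaIdentitiesFortyFour` (the E₂ road: (I1)₄₄, (I2a)₄₄, (I2b)₄₄ and (S2)₄₄ `Λ(φ) ⊆ Λ(−32/3, 208/27)`), joined with p3 g24's general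
Néron squeeze (`NeronSqueeze.abs_maninConstant_eq_one_of_periodLattice_le`) at `W₀ = 44a1 = [0, 1, 0, 3, −1]`.

* §1 `44a1 = [0, 1, 0, 3, −1]`: elliptic, globally minimal, `N = 44` (all three ALREADY in the tree: `AddPotGoodPrint.isElliptic_44A1`,
  `isGloballyMinimal_44A1`, `conductorNorm_44A1` — cited, not restated), Néron invariants `(c₄/12, c₆/216) = (−32/3, 208/27)`;
* §2 **`abs_maninConstant_eq_one_fortyFour`: for every globally minimal elliptic `W/ℚ` and every `X₀(44)`-datum `D` of `W` with the
  lattice clause, `|D.maninConstant| = 1`**, hence **`2 ∤ c`** — the body of C2 at `N = 44` with NONE of the item's hypotheses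
  (no Mazur, Abbes–Ullmo, Česnavičius, modularity, CDT);
* §3 the `X₀(44)`-domain is inhabited GIVEN the item's own binder `exists_isNewformOf`, and the item-shaped statement
  `maninOddAtFour_fortyFour`.

HONEST FRAMING: unconditional (standard axioms) except §3's inhabitation (conditional on `exists_isNewformOf`, the item's binder).
The `∀ N` crux C2, Manin's conjecture and BSD are NOT proved; item 22967 stays OPEN as filed.  No definition, no named fact, no sorry.
[cite: AgasheRibetStein2006, §§1–2] [cite: CremonaAlgorithms1997, Table 1 (44a1)] [cite: EdixhovenManin1991, Prop. 2]
[cite: DiamondShurman2005, Thm. 8.8.3]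
-/

set_option autoImplicit false
-- lint-debt: the directory name repeats the summit name (sibling precedent `ManinLocalTwoThreeManinConstantSeventyTwo.lean`)
set_option linter.dupNamespace false

noncomputable section

open Complex Filter Topology Set Function
open UpperHalfPlane hiding I
open scoped Real Topology Manifold MatrixGroups ModularForm
open ModularForm CongruenceSubgroup WeierstrassCurve
open Literature.NumberTheory.EllipticCurves Literature.NumberTheory.EllipticCurves.ModularForms
open Literature.NumberTheory.Automorphic

namespace Summit.BirchSwinnertonDyer.BirchSwinnertonDyer.Theorems.ManinLocalTwoThree.ManinConstantFortyFour

open LevelFortyFour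
open AddPotGoodPrint (isElliptic_44A1 isGloballyMinimal_44A1 conductorNorm_44A1)

/-! ## §1 The Néron invariants of `44a1 = [0, 1, 0, 3, −1]` -/

/-- **The Néron invariants of `44a1`**: `c₄ = −128`, `c₆ = 1664`, so `IsNeronLatticeOf (W₀/ℂ) L ⟸ (g₂(L), g₃(L)) = (−32/3, 208/27)`.
[cite: CremonaAlgorithms1997, Table 1 (44a1)] -/
theorem isNeronLatticeOf_fortyFourA1 {L₁ : PeriodPair} (hg2 : L₁.g₂ = -32 / 3) (hg3 : L₁.g₃ = 208 / 27) :
    IsNeronLatticeOf ((⟨0, 1, 0, 3, -1⟩ : WeierstrassCurve ℚ).baseChange ℂ) L₁ := by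
  constructor
  · rw [hg2]
    norm_num [WeierstrassCurve.baseChange, WeierstrassCurve.map_c₄, WeierstrassCurve.c₄,
      WeierstrassCurve.b₂, WeierstrassCurve.b₄]
  · rw [hg3]
    norm_num [WeierstrassCurve.baseChange, WeierstrassCurve.map_c₆, WeierstrassCurve.c₆,
      WeierstrassCurve.b₂, WeierstrassCurve.b₄, WeierstrassCurve.b₆]

/-! ## §2 The squeeze: `|c| = 1` and `2 ∤ c` on `X₀(44)`, unconditionally -/

/-- **`|c| = 1` on `X₀(44)`, UNCONDITIONALLY**: for every globally minimal elliptic `W/ℚ` and every `X₀(44)`-parametrisation datum `D`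
of `W` with the lattice clause `Λ_W = c·Λ(D.f)` — `⇑D.f = ⇑Φ₄₄` by the fact-free pinning, `D.f ≠ 0` (`RatioBridge.f_ne_zero`), (S2)₄₄
`periodLatticeLe_fortyFour`, and the Néron squeeze with `W₀ = 44a1`. [cite: AgasheRibetStein2006, §§1–2] -/
theorem abs_maninConstant_eq_one_fortyFour (W : WeierstrassCurve ℚ) [W.IsElliptic] [W.IsGloballyMinimal]
    (D : ModularParametrizationData W 44)
    (hopt : ∀ z ∈ D.L.lattice, ∃ w ∈ periodLattice D.f, z = D.c * w) :
    |D.maninConstant| = 1 := by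
  haveI := isElliptic_44A1
  haveI := isGloballyMinimal_44A1
  haveI : NeZero (44 : ℕ) := ⟨by decide⟩
  obtain ⟨L₁, hg2, hg3, hle⟩ := periodLatticeLe_fortyFour D.f (RatioBridge.f_ne_zero D) (f_apply_eq_phi44 D)
  exact NeronSqueeze.abs_maninConstant_eq_one_of_periodLattice_le (⟨0, 1, 0, 3, -1⟩ : WeierstrassCurve ℚ) L₁
    (isNeronLatticeOf_fortyFourA1 hg2 hg3) W D hle hopt

/-- **`2 ∤ c` on `X₀(44)`, UNCONDITIONALLY** — the body of the crux C2 `ManinOddAtFour` at `N = 44` (`2² ∣ 44`) with none of its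
fact hypotheses. [cite: AgasheRibetStein2006, §§1–2] -/
theorem not_two_dvd_maninConstant_fortyFour (W : WeierstrassCurve ℚ) [W.IsElliptic] [W.IsGloballyMinimal]
    (D : ModularParametrizationData W 44)
    (hopt : ∀ z ∈ D.L.lattice, ∃ w ∈ periodLattice D.f, z = D.c * w) :
    ¬ (2 : ℤ) ∣ D.maninConstant := by
  have h := abs_maninConstant_eq_one_fortyFour W D hopt
  intro h2
  have := Int.le_of_dvd (by rw [h]; norm_num) ((dvd_abs _ _).mpr h2)
  rw [h] at this
  norm_num at this

/-- **No prime divides `c` on `X₀(44)`.** [cite: AgasheRibetStein2006, §§1–2] -/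
theorem not_prime_dvd_maninConstant_fortyFour (W : WeierstrassCurve ℚ) [W.IsElliptic] [W.IsGloballyMinimal]
    (D : ModularParametrizationData W 44)
    (hopt : ∀ z ∈ D.L.lattice, ∃ w ∈ periodLattice D.f, z = D.c * w) {p : ℕ} (hp : p.Prime) :
    ¬ (p : ℤ) ∣ D.maninConstant := by
  have h := abs_maninConstant_eq_one_fortyFour W D hopt
  intro hd
  have h1 := Int.le_of_dvd (by rw [h]; norm_num) ((dvd_abs _ _).mpr hd)
  rw [h] at h1
  have h2 := hp.two_le
  omega

/-! ## §3 The `X₀(44)`-domain is inhabited GIVEN the item's binder `exists_isNewformOf`; the item-shaped statement -/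

/-- **Modularity at `44a1`, levelled**: under `exists_isNewformOf` the curve `[0, 1, 0, 3, −1]` has a newform in `S₂(Γ₀(44))` (its conductor
IS `44`, tree `AddPotGoodPrint.conductorNorm_44A1`).  CONDITIONAL on the item's own binder. [cite: DiamondShurman2005, Thm. 8.8.3] -/
theorem exists_isNewformOf_fortyFourA1 (hnf : exists_isNewformOf) :
    ∃ f : CuspForm (Gamma0 44) 2, IsNewformOf (⟨0, 1, 0, 3, -1⟩ : WeierstrassCurve ℚ) f := by
  haveI := isElliptic_44A1
  have key : ∀ (N : ℕ) [NeZero N], (⟨0, 1, 0, 3, -1⟩ : WeierstrassCurve ℚ).conductorNorm ℤ = N →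
      ∃ f : CuspForm (Gamma0 N) 2, IsNewformOf (⟨0, 1, 0, 3, -1⟩ : WeierstrassCurve ℚ) f := by
    intro N _ hN
    subst hN
    exact hnf _
  haveI : NeZero (44 : ℕ) := ⟨by decide⟩
  exact key 44 conductorNorm_44A1

/-- **A lattice-optimal `X₀(44)`-datum on a globally minimal curve of the class `44a` exists under modularity**, and it has `|c| = 1`.
CONDITIONAL on `exists_isNewformOf` only. [cite: EdixhovenManin1991, Prop. 2] [cite: DiamondShurman2005, Thm. 8.8.3] -/
theorem domain_inhabited_fortyFour_of_modularity (hnf : exists_isNewformOf) :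
    ∃ (W₀ : WeierstrassCurve ℚ) (_ : W₀.IsElliptic) (_ : W₀.IsGloballyMinimal) (D₀ : ModularParametrizationData W₀ 44),
      (⟨0, 1, 0, 3, -1⟩ : WeierstrassCurve ℚ).IsIsogenous W₀ ∧ (∀ z ∈ D₀.L.lattice, ∃ w ∈ periodLattice D₀.f, z = D₀.c * w) ∧
      |D₀.maninConstant| = 1 := by
  haveI := isElliptic_44A1
  haveI : NeZero (44 : ℕ) := ⟨by decide⟩
  obtain ⟨f, hf⟩ := exists_isNewformOf_fortyFourA1 hnf
  obtain ⟨D⟩ := nonempty_modularParametrizationData_of_isNewformOf hf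
  obtain ⟨W₀, h₀, hmin, D₀, -, hiso, hopt, -⟩ :=
    ExistsMinimalOptimalDatum.existsMinimalOptimalDatum_full (⟨0, 1, 0, 3, -1⟩ : WeierstrassCurve ℚ) D
  exact ⟨W₀, h₀, hmin, D₀, hiso, hopt, @abs_maninConstant_eq_one_fortyFour W₀ h₀ hmin D₀ hopt⟩

/-- **C2's body at `N = 44` in the item's literal shape**: `2² ∣ 44 → 2 ∤ c(D)` for every datum with the lattice clause, and the domain is
inhabited GIVEN `exists_isNewformOf`. [cite: AgasheRibetStein2006, §§1–2] -/
theorem maninOddAtFour_fortyFour (hnf : exists_isNewformOf) :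
    (∃ (W₀ : WeierstrassCurve ℚ) (_ : W₀.IsElliptic) (_ : W₀.IsGloballyMinimal) (D₀ : ModularParametrizationData W₀ 44),
        (∀ z ∈ D₀.L.lattice, ∃ w ∈ periodLattice D₀.f, z = D₀.c * w) ∧ |D₀.maninConstant| = 1) ∧
      ∀ (W : WeierstrassCurve ℚ) [W.IsElliptic] [W.IsGloballyMinimal] (D : ModularParametrizationData W 44),
        (∀ z ∈ D.L.lattice, ∃ w ∈ periodLattice D.f, z = D.c * w) → 2 ^ 2 ∣ 44 → ¬ (2 : ℤ) ∣ D.maninConstant := by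
  refine ⟨?_, fun W _ _ D hopt _ ↦ not_two_dvd_maninConstant_fortyFour W D hopt⟩
  obtain ⟨W₀, h₀, hmin, D₀, -, hopt, habs⟩ := domain_inhabited_fortyFour_of_modularity hnf
  exact ⟨W₀, h₀, hmin, D₀, hopt, habs⟩

end Summit.BirchSwinnertonDyer.BirchSwinnertonDyer.Theorems.ManinLocalTwoThree.ManinConstantFortyFour

end
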